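import Literature.AlgebraicGeometry.Frobenioids.MotivatingExamplesSubThm62Closure
import Literature.AlgebraicGeometry.Frobenioids.FinSubextCatPadicRigidSextic
import HarnessLib

/-!
# Frobenioids I, §0 / Thm. 6.2 (iii): the base category `D = B(G)⁰` of finite subextensions of `ℚ_17/ℚ` is NOT
# of FSMFF-type — clause (d) of "standard type" fails without the Galois hypothesis

Mochizuki, *The geometry of Frobenioids I: the general theory*, Kyushu J. Math. **62** (2008) 293–400, §0
pp. 17–18 ("`C` is of FSMFF-type if every FSM-morphism that is not an isomorphism factors as a composite of
finitely many FSMI-morphisms, and …"), proof of Thm. 6.2 (iii) p. 111 ("It is immediate that every monomorphism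
of `D` is an isomorphism, hence that `D` is of FSM-type [hence also of FSMFF-type — cf. §0]") — an inference
that uses the standing hypothesis "`K̃/K` Galois" of Example 6.1 (p. 109). [cite: MochizukiFrdI2008, §0 p.17]
[cite: MochizukiFrdI2008, Thm. 6.2 (iii) p.111]

PROOF-ONLY companion (cell abc-iut, block F fact-proving wave, seat abc-iut-f-043; toward FACT-LIST row F-1137
`Thm62iii_L06_standard`, whose clause (d) is `IsOfFSMFFType (FinSubextCat K Kt)`). No definitions.

THE EXAMPLE. `K = ℚ ⊆ Kt = ℚ_17`, with the rigid sextic `γ` (`γ³ = 5 + 2s`, `s² = 2`) of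
`Literature.NumberTheory.LocalFields.padic_seventeen_rigid_sextic` and the subfield facts of
`FinSubextCatPadicRigidSextic.lean` (`[ℚ(γ) : ℚ] = 6`, rigidity, the only subfield of degree `2` or `3` is `ℚ(s)`).
In `D = FinSubextCat ℚ ℚ_[17]`:
* degrees grow strictly along non-invertible arrows, so an FSMI-chain `Spec L → ⋯ → Spec M` of length `n` has
  `[M : ℚ] + n ≤ [L : ℚ]` (clause (b) of FSMFF-type holds for every `Kt/K`, `finrank_add_le_of_isFSMIChain`);
* `Spec ℚ(s) → Spec ℚ` admits NO FSMI-chain (`padic17_not_isFSMIChain_adjoin_s`): a single FSMI-morphism would be a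
  monomorphism equalising the identity and the twist `s ↦ −s` of `Spec ℚ(s)`; a longer chain would pass through
  a field of degree `< 1`;
* `φ : Spec ℚ(γ) → Spec ℚ` is an FSM-morphism (rigidity, `FinSubextCat.isFSM_of_rigid`), not an isomorphism, and
  admits NO FSMI-chain (`padic17_not_isFSMIChain_adjoin_γ`): it is not irreducible (it factors through
  `Spec ℚ(s)`, degrees `6 > 2 > 1`), and in a chain `ψ ≫ χ` the middle field has degree `2` or `3` dividing `6`,
  hence is `ℚ(s)`, and `χ` would be an FSMI-chain `Spec ℚ(s) → Spec ℚ`.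
Hence **`FinSubextCat ℚ ℚ_[17]` is not of FSMFF-type** (`FinSubextCat.not_isOfFSMFFType_rat_padic`). Nothing
here bears on [IUTchIII] Cor. 3.12 or asserts anything about abc.
-/

noncomputable section

namespace Literature.AlgebraicGeometry.Frobenioids

open CategoryTheory Opposite Function IntermediateField Polynomial
open Literature.NumberTheory.LocalFields

/-! ### Degrees along arrows of `D = FinSubextCat K Kt` (any `Kt/K`) -/

namespace FinSubextCat

section Degrees

variable {K : Type} [Field K] {Kt : Type} [Field Kt] [Algebra K Kt]

/-- Along `Spec L → Spec M` the field map `M → L` is injective, so `[M : K] ≤ [L : K]`.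
[cite: MochizukiFrdI2008, Ex. 6.1 p.109] -/
theorem finrank_le_of_hom {X Y : FinSubextCat K Kt} (f : X ⟶ Y) :
    Module.finrank K Y.L ≤ Module.finrank K X.L :=
  LinearMap.finrank_le_finrank_of_injective (f := f.toAlgHom.toLinearMap) (f.toAlgHom : Y.L →+* X.L).injective

/-- An arrow `Spec L → Spec M` that is not an isomorphism strictly raises the degree: `[M : K] < [L : K]` (equal
degrees would make the field map bijective). [cite: MochizukiFrdI2008, Thm. 6.2 (iii) p.111] -/
theorem finrank_lt_of_not_isIso {X Y : FinSubextCat K Kt} (f : X ⟶ Y) (hf : ¬ IsIso f) :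
    Module.finrank K Y.L < Module.finrank K X.L := by
  refine lt_of_le_of_ne (finrank_le_of_hom f) fun heq => hf ?_
  have hsurj : Surjective f.toAlgHom.toLinearMap :=
    (LinearMap.injective_iff_surjective_of_finrank_eq_finrank heq).mp (f.toAlgHom : Y.L →+* X.L).injective
  exact FinSubextCat.isIso_of_bijective f ⟨(f.toAlgHom : Y.L →+* X.L).injective, fun y => hsurj y⟩

/-- Isomorphic objects have equal degree. [cite: MochizukiFrdI2008, Ex. 6.1 p.109] -/
theorem finrank_eq_of_isIso {X Y : FinSubextCat K Kt} (f : X ⟶ Y) [IsIso f] :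
    Module.finrank K Y.L = Module.finrank K X.L :=
  le_antisymm (finrank_le_of_hom f) (finrank_le_of_hom (inv f))

/-- **Clause (b) of FSMFF-type for every `Kt/K`, quantitatively**: an FSMI-chain `Spec L → ⋯ → Spec M` of
length `n` has `[M : K] + n ≤ [L : K]` (each FSMI-morphism is not an isomorphism). [cite: MochizukiFrdI2008, §0 p.17] -/
theorem finrank_add_le_of_isFSMIChain {X Y : FinSubextCat K Kt} {χ : X ⟶ Y} {n : ℕ} (h : IsFSMIChain χ n) :
    Module.finrank K Y.L + n ≤ Module.finrank K X.L := by
  induction h with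
  | single φ hφ => exact finrank_lt_of_not_isIso φ hφ.2.1
  | cons ψ χ n hψ _ ih => have := finrank_lt_of_not_isIso ψ hψ.2.1; omega

end Degrees

/-! ### No FSMI-chains `Spec ℚ(√2) → Spec ℚ`, `Spec ℚ(γ) → Spec ℚ` -/

section Padic17

variable [Fact (Nat.Prime 17)] {s γ : ℚ_[17]} (hs : s ^ 2 = 2) (hγ : γ ^ 3 = 5 + 2 * s)
  (hN : ∀ x : ℚ_[17], x ^ 3 ≠ 5 - 2 * s) (hR : ∀ g : ℚ_[17], g ^ 6 - 10 * g ^ 3 + 17 = 0 → g = γ)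

include hs in
/-- **`Spec ℚ(√2) → Spec ℚ` admits no FSMI-chain**: a single FSMI-morphism would be a monomorphism, but it
equalises the identity and the twist `√2 ↦ −√2` of `Spec ℚ(√2)`; a longer chain would pass through a field of
degree `< 1`. [cite: MochizukiFrdI2008, §0 p.17] -/
theorem padic17_not_isFSMIChain_adjoin_s [FiniteDimensional ℚ ℚ⟮s⟯] {n : ℕ}
    {χ : (FinSubextCat.mk ℚ⟮s⟯ : FinSubextCat ℚ ℚ_[17]) ⟶ FinSubextCat.mk ⊥} (h : IsFSMIChain χ n) : False := by
  -- the twist of `Spec ℚ(s)`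
  let pb := adjoin.powerBasis (padic17_isIntegral_s hs)
  have hneg : -s ∈ ℚ⟮s⟯ := neg_mem (mem_adjoin_simple_self ℚ s)
  have hroot : aeval (⟨-s, hneg⟩ : ℚ⟮s⟯) (minpoly ℚ pb.gen) = 0 := by
    apply (algebraMap ℚ⟮s⟯ ℚ_[17]).injective
    rw [map_zero, ← aeval_algebraMap_apply, IntermediateField.algebraMap_apply,
      padic17_minpoly_powerBasis_gen hs]
    simp only [map_sub, map_pow, aeval_X, map_ofNat, neg_sq, hs, sub_self]
  let τ : ℚ⟮s⟯ →ₐ[ℚ] ℚ⟮s⟯ := pb.lift ⟨-s, hneg⟩ hroot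
  have hτs : τ (AdjoinSimple.gen ℚ s) = ⟨-s, hneg⟩ := by
    rw [← adjoin.powerBasis_gen (padic17_isIntegral_s hs)]
    exact pb.lift_gen _ hroot
  cases h with
  | single _ hχ =>
    haveI := hχ.1.2
    let t : (FinSubextCat.mk ℚ⟮s⟯ : FinSubextCat ℚ ℚ_[17]) ⟶ FinSubextCat.mk ℚ⟮s⟯ := FinSubextCat.Hom.mk τ
    have heq : t ≫ χ = 𝟙 _ ≫ χ := FinSubextCat.hom_ext (FinSubextCat.algHom_bot_eq _ _)
    have ht : t = 𝟙 _ := (cancel_mono χ).mp heq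
    have h1 : τ (AdjoinSimple.gen ℚ s) = AdjoinSimple.gen ℚ s := by
      have := congrArg (fun f : (FinSubextCat.mk ℚ⟮s⟯ : FinSubextCat ℚ ℚ_[17]) ⟶ FinSubextCat.mk ℚ⟮s⟯ =>
        f.toAlgHom (AdjoinSimple.gen ℚ s)) ht
      exact this
    rw [hτs] at h1
    exact padic17_s_ne_neg hs (by simpa using (congrArg Subtype.val h1).symm)
  | cons ψ χ' k hψ hχ' =>
    have h1 := finrank_lt_of_not_isIso ψ hψ.2.1
    have h2 := finrank_add_le_of_isFSMIChain hχ'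
    have h3 := hχ'.pos
    simp only [(padic17_adjoin_s_degree hs).2, IntermediateField.finrank_bot] at h1 h2
    omega

include hs hγ hN hR in
/-- **`Spec ℚ(γ) → Spec ℚ` admits no FSMI-chain.** A single FSMI-morphism would be irreducible, but the arrow
factors through `Spec ℚ(√2)` with neither factor an isomorphism; in a longer chain `ψ ≫ χ` the middle field
has degree `2` or `3` dividing `6`, hence is `ℚ(√2)` (`padic17_subfield_eq_adjoin_s`), and `χ` would be an
FSMI-chain `Spec ℚ(√2) → Spec ℚ`. [cite: MochizukiFrdI2008, §0 p.17] -/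
theorem padic17_not_isFSMIChain_adjoin_γ [FiniteDimensional ℚ ℚ⟮γ⟯] [FiniteDimensional ℚ ℚ⟮s⟯] {n : ℕ}
    {χ : (FinSubextCat.mk ℚ⟮γ⟯ : FinSubextCat ℚ ℚ_[17]) ⟶ FinSubextCat.mk ⊥} (h : IsFSMIChain χ n) :
    False := by
  have h6 := padic17_finrank_adjoin_γ hs hγ hN hR
  have h2 := (padic17_adjoin_s_degree hs).2
  cases h with
  | single _ hχ =>
    -- `χ` is not irreducible: it factors through `Spec ℚ(s)`
    have hle : ℚ⟮s⟯ ≤ ℚ⟮γ⟯ := adjoin_simple_le_iff.mpr (padic17_s_mem_adjoin_γ hγ)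
    let β : (FinSubextCat.mk ℚ⟮γ⟯ : FinSubextCat ℚ ℚ_[17]) ⟶ FinSubextCat.mk ℚ⟮s⟯ :=
      FinSubextCat.Hom.mk (IntermediateField.inclusion hle)
    let α : (FinSubextCat.mk ℚ⟮s⟯ : FinSubextCat ℚ ℚ_[17]) ⟶ FinSubextCat.mk ⊥ :=
      FinSubextCat.Hom.mk (IntermediateField.inclusion bot_le)
    have hcomp : β ≫ α = χ := FinSubextCat.hom_ext (FinSubextCat.algHom_bot_eq _ _)
    rcases hχ.2.2 β α hcomp with hα | hβ
    · have h := finrank_eq_of_isIso α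
      change Module.finrank ℚ (⊥ : IntermediateField ℚ ℚ_[17]) = Module.finrank ℚ ℚ⟮s⟯ at h
      rw [IntermediateField.finrank_bot, h2] at h
      omega
    · have h := finrank_eq_of_isIso β
      change Module.finrank ℚ ℚ⟮s⟯ = Module.finrank ℚ ℚ⟮γ⟯ at h
      rw [h2, h6] at h
      omega
  | @cons _ X₁ _ ψ χ' k hψ hχ' =>
    obtain ⟨L₁, fin₁⟩ := X₁
    -- the middle field `L₁` has degree `2` or `3`, dividing `6`
    have hlt := finrank_lt_of_not_isIso ψ hψ.2.1
    have hge := finrank_add_le_of_isFSMIChain hχ'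
    have hpos := hχ'.pos
    rw [IntermediateField.finrank_bot] at hge
    change Module.finrank ℚ L₁ < Module.finrank ℚ ℚ⟮γ⟯ at hlt
    change 1 + k ≤ Module.finrank ℚ L₁ at hge
    rw [h6] at hlt
    let f : L₁ →ₐ[ℚ] ℚ_[17] := (ℚ⟮γ⟯).val.comp ψ.toAlgHom
    have hS : f.fieldRange ≤ ℚ⟮γ⟯ := by
      rintro y ⟨x, rfl⟩
      exact (ψ.toAlgHom x).2
    have hfr : Module.finrank ℚ f.fieldRange = Module.finrank ℚ L₁ :=
      (LinearEquiv.finrank_eq f.equivFieldRange.toLinearEquiv).symm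
    have hdvd : Module.finrank ℚ L₁ ∣ 6 := by
      rw [← hfr, ← h6]
      exact IntermediateField.finrank_dvd_of_le_right hS
    have hd : Module.finrank ℚ f.fieldRange = 2 ∨ Module.finrank ℚ f.fieldRange = 3 := by
      rw [hfr]
      obtain ⟨c, hc⟩ := hdvd
      have h1 : 2 ≤ Module.finrank ℚ L₁ := by omega
      have h5 : Module.finrank ℚ L₁ < 6 := hlt
      interval_cases (Module.finrank ℚ L₁) <;> omega
    -- hence it is `ℚ(s)`: `s ∈ L₁` and `L₁ = ℚ(s)`
    have hSeq := padic17_subfield_eq_adjoin_s hs hγ hN hR f.fieldRange hS hd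
    have hsX : s ∈ L₁ := by
      have hsr : s ∈ f.fieldRange := hSeq ▸ mem_adjoin_simple_self ℚ s
      obtain ⟨x, hx⟩ := hsr
      have hx' : f x = s := hx
      have hx2 : ((x : ℚ_[17])) ^ 2 = s ^ 2 := by
        have hfx : f (x ^ 2) = f 2 := by rw [map_pow, hx', hs, map_ofNat]
        have h2' : ((2 : L₁) : ℚ_[17]) = 2 := rfl
        have := congrArg (fun z : L₁ => (z : ℚ_[17])) (f.injective hfx)
        simp only [SubmonoidClass.coe_pow, h2'] at this
        rw [this, hs]
      rcases eq_or_eq_neg_of_sq_eq_sq _ _ hx2 with h | h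
      · exact h ▸ x.2
      · have : s = -(x : ℚ_[17]) := by rw [h, neg_neg]
        exact this ▸ neg_mem x.2
    have hX2 : Module.finrank ℚ L₁ = 2 := by rw [← hfr, hSeq, h2]
    have hXeq : ℚ⟮s⟯ = L₁ :=
      IntermediateField.eq_of_le_of_finrank_eq (adjoin_simple_le_iff.mpr hsX) (by rw [h2, hX2])
    -- transport the chain `χ'` to `Spec ℚ(s) → Spec ℚ`
    subst hXeq
    exact padic17_not_isFSMIChain_adjoin_s hs hχ'

end Padic17

/-- **`D = FinSubextCat ℚ ℚ_[17]` is NOT of FSMFF-type** (clause (a) fails at the FSM-morphism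
`Spec ℚ(γ) → Spec ℚ`, `γ³ = 5 + 2√2` the rigid sextic number of `ℚ_17`): contrast FrdI p. 111, where `K̃/K`
Galois makes `D` of FSM-type, hence of FSMFF-type. [cite: MochizukiFrdI2008, Thm. 6.2 (iii) p.111] -/
theorem not_isOfFSMFFType_rat_padic [Fact (Nat.Prime 17)] : ¬ IsOfFSMFFType (FinSubextCat ℚ ℚ_[17]) := by
  obtain ⟨s, γ, hs, hγ, hN, hR⟩ := padic_seventeen_rigid_sextic
  have hγint := padic17_isIntegral_γ hs hγ
  haveI : FiniteDimensional ℚ ℚ⟮γ⟯ := adjoin.finiteDimensional hγint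
  haveI : FiniteDimensional ℚ ℚ⟮s⟯ := adjoin.finiteDimensional (padic17_isIntegral_s hs)
  intro hD
  -- the FSM-morphism `φ : Spec ℚ(γ) → Spec ℚ`, not an isomorphism
  let φ : (FinSubextCat.mk ℚ⟮γ⟯ : FinSubextCat ℚ ℚ_[17]) ⟶ FinSubextCat.mk ⊥ :=
    FinSubextCat.Hom.mk (IntermediateField.inclusion bot_le)
  have hφ : IsFSM φ :=
    FinSubextCat.isFSM_of_rigid γ hγint fun ψ =>
      padic17_algHom_apply_γ hs hγ hR ℚ⟮γ⟯ (mem_adjoin_simple_self ℚ γ) ψ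
  have hφiso : ¬ IsIso φ := by
    intro hiso
    have h := finrank_eq_of_isIso φ
    change Module.finrank ℚ (⊥ : IntermediateField ℚ ℚ_[17]) = Module.finrank ℚ ℚ⟮γ⟯ at h
    rw [IntermediateField.finrank_bot, padic17_finrank_adjoin_γ hs hγ hN hR] at h
    omega
  obtain ⟨n, hchain⟩ := hD.factors φ hφ hφiso
  exact padic17_not_isFSMIChain_adjoin_γ hs hγ hN hR hchain

end FinSubextCat

end Literature.AlgebraicGeometry.Frobenioids

end
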